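import Summits.BirchSwinnertonDyer.Rank1Residual.ManinAdditive.UDCKummerLineHolds
import Summits.BirchSwinnertonDyer.BirchSwinnertonDyer.Theorems.ManinLocalTwoThreeUDCLineAtNine
import Summits.BirchSwinnertonDyer.BirchSwinnertonDyer.Theorems.ManinLocalTwoThreeKummerCubeQExpansionPrinciple
import Literature.NumberTheory.Automorphic.UnboundedDenominatorsReductions
import HarnessLib

/-!
# an's `UnboundedDenominatorsWeight k` follows from the tree's vendored Unbounded Denominators fact
(route `ManinLocalTwoThree`, crux C3 `ManinPrimeToThreeAtNine` stmt-BirchSwinnertonDyer-22968; cell bsd-f2-manin, p2 gen 17;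
`--supports stmt-BirchSwinnertonDyer-22968`; the UDC conjunct of the C3 v21 cite stub `stub_printInputsUDC`)

The UDC line of MEMO-an §80.12 (`ManinAdditive/UDCKummerLine.lean`, T-an-43) consumes the Unbounded Denominators theorem of
Calegari–Dimitrov–Tang in an's UNBUNDLED rendering `UDCKummerLine.UnboundedDenominatorsWeight k`: `F : ℍ → ℂ` holomorphic, weight-`k`
invariant under a finite-index `Γ ≤ SL(2, ℤ)`, of at most EXPONENTIAL GROWTH at every cusp (`‖(F|g)(τ)‖ ≤ C e^{m·Im τ}`), with an INTEGER
`q`-expansion of width `1` at `i∞` ⟹ `F` is `Γ(M)`-invariant for some `M ≥ 1`.  The tree vendors the printed Theorem 1.0.1 in its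
HOLOMORPHIC-at-the-cusps, bundled form `Literature.NumberTheory.Automorphic.CalegariDimitrovTang2025_unboundedDenominators` (Mathlib
`ModularForm Γ k`, integer `qExpansion h` at a strict period `h`), which does not imply an's rendering syntactically (typer g20 note).  Here:

* **`unboundedDenominatorsWeight_of_CDT : CalegariDimitrovTang2025_unboundedDenominators → ∀ k, UnboundedDenominatorsWeight k`**.

PROOF (the `Δ`-power trick, kernel-exact).  (1) `F(τ + 1) = F(τ)` from the width-`1` series, so `F` is invariant under `K :=` the
stabiliser of `f := F·Δ^{k′}` in `SL(2, ℤ)` for the weight `k + 12k′`, which contains `Γ` and `T` (finite index, strict period `1`);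
`Δ^{k′}` is invariant under all of `SL(2, ℤ)` (`slash_action_generators_SL2Z`).  (2) `k′ ≥ m_g` for the finitely many right cosets `Γg`
(`k′ := Σ_{cosets} ⌈m⌉₊`): then `‖(f|g)(τ)‖ = ‖(F|g)(τ)‖·‖Δ(τ)‖^{k′} ≤ C e^{m Im τ}·(C_Δ e^{−2π Im τ})^{k′}` is BOUNDED at `i∞` for every
`g ∈ SL(2, ℤ)` (Mathlib `CuspFormClass.exp_decay_atImInfty` for `Δ`), i.e. `f` is bounded at every cusp
(`OnePoint.isBoundedAt_iff_forall_SL2Z`), so `f : ModularForm K (k + 12k′)`.  (3) Its `qExpansion 1` has INTEGER coefficients: the Cauchy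
product of `Σ bₙqⁿ` with the integer series of `Δ^{k′}` (tree `exists_discriminant_qExpansion_eq_map`, `hasSum_coeff_mul_pow_mul`) sums to
`f`, and `q`-expansions are unique (`ModularFormClass.qExpansion_coeff_unique`).  (4) The vendored fact gives a congruence level, i.e.
(`exists_congruence_modularForm_coe_eq_iff`) `f|γ = f` for `γ ∈ Γ(N)`, `N ≠ 0`; dividing by `Δ^{k′} ≠ 0` (`mul_slash_SL2`,
`ModularForm.discriminant_ne_zero`) gives `F|γ = F`.

HONEST FRAMING.  A REDUCTION between two renderings of ONE printed theorem (no new mathematics); with it the C3 v21 cite stub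
`stub_printInputsUDC = (∀ k, UnboundedDenominatorsWeight k) ∧ TypeIINoncongruence` is (vendored CDT fact BY NAME) ∧ (typer's theorem
`typeIINoncongruence_holds`).  The CONTENT stub (AN♮) `KummerCubeRootCongruenceOfBoundedOfUDC` is NOT touched.  BSD is not proved by this;
Manin's conjecture is not proved; C3 `ManinPrimeToThreeAtNine` (and C2) remain OPEN.
[cite: CalegariDimitrovTang2025, Thm. 1.0.1 (both renderings are special cases of the printed statement; the Δ-power passage is folklore)]
-/

set_option autoImplicit false
-- lint-debt: the directory name repeats the summit name (sibling precedent `ManinLocalTwoThreeKummerCubeNotCube.lean`)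
set_option linter.dupNamespace false

noncomputable section

open scoped MatrixGroups ModularForm Manifold Topology
open Complex UpperHalfPlane CongruenceSubgroup PowerSeries Filter Asymptotics
open Literature.NumberTheory.Automorphic
open Summit.BirchSwinnertonDyer.Rank1Residual.ManinAdditive.UDCKummerLine

namespace Summit.BirchSwinnertonDyer.BirchSwinnertonDyer.Theorems.ManinLocalTwoThree.UDWOfCDT

/-! ### §1 `Δ^{k′}`: level-one invariance, decay, integer `q`-series -/

/-- `Δ^{n}` is invariant under all of `SL(2, ℤ)` in weight `12n`. [folklore] -/
theorem discriminant_pow_slash (n : ℕ) (A : SL(2, ℤ)) :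
    (fun τ : ℍ ↦ ModularForm.discriminant τ ^ n) ∣[(12 * (n : ℤ))] A =
      fun τ : ℍ ↦ ModularForm.discriminant τ ^ n := by
  induction n with
  | zero =>
    funext τ
    rw [ModularForm.SL_slash_apply]
    simp
  | succ n ih =>
    have hΔ : ModularForm.discriminant ∣[(12 : ℤ)] A = ModularForm.discriminant :=
      SlashInvariantForm.slash_action_generators_SL2Z ModularForm.discriminant_S_invariant
        ModularForm.discriminant_T_invariant A
    have hsplit : (fun τ : ℍ ↦ ModularForm.discriminant τ ^ (n + 1)) =
        (fun τ : ℍ ↦ ModularForm.discriminant τ ^ n) * ModularForm.discriminant := by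
      funext τ; simp [pow_succ]
    rw [hsplit, show (12 * ((n + 1 : ℕ) : ℤ)) = 12 * (n : ℤ) + 12 by push_cast; ring,
      ModularForm.mul_slash_SL2, ih, hΔ]

/-- Exponential decay of `Δ` at `i∞` with explicit constants: `‖Δ(τ)‖ ≤ C·e^{−2π Im τ}` for `Im τ ≥ A`. [folklore] -/
theorem exists_norm_discriminant_le :
    ∃ C A : ℝ, 0 ≤ C ∧ ∀ τ : ℍ, A ≤ τ.im → ‖ModularForm.discriminant τ‖ ≤ C * Real.exp (-2 * Real.pi * τ.im) := by
  have h := CuspFormClass.exp_decay_atImInfty (h := 1) CuspForm.discriminant one_pos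
    one_mem_strictPeriods_SL
  obtain ⟨C, hC⟩ := h.bound
  obtain ⟨A, hA⟩ := (UpperHalfPlane.atImInfty_mem _).mp hC
  refine ⟨max C 0, A, le_max_right _ _, fun τ hτ ↦ ?_⟩
  have h1 := hA τ hτ
  simp only [Set.mem_setOf_eq, CuspForm.coe_discriminant, div_one, Real.norm_eq_abs,
    Real.abs_exp] at h1
  exact h1.trans (mul_le_mul_of_nonneg_right (le_max_left _ _) (Real.exp_pos _).le)

/-- The `q`-series of `Δ` at period `1` (Mathlib's `qExpansion 1`) sums to `Δ`. [folklore] -/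
theorem hasSum_qExpansion_discriminant (τ : ℍ) :
    HasSum (fun m : ℕ ↦ coeff m (qExpansion 1 ModularForm.discriminant) * Function.Periodic.qParam 1 (τ : ℂ) ^ m)
      (ModularForm.discriminant τ) := by
  have h := UpperHalfPlane.hasSum_qExpansion one_pos
    (SlashInvariantFormClass.periodic_comp_ofComplex (CuspForm.discriminant) one_mem_strictPeriods_SL)
    (CuspForm.discriminant).holo' (ModularFormClass.bdd_at_infty CuspForm.discriminant) τ
  simpa [smul_eq_mul] using h

/-- The `q`-series of `Δ^{n}`: with `qExpansion 1 Δ = D` (an integer series), `Σ coeff_m(D^{n}) qᵐ = Δ(τ)^{n}`. [folklore] -/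
theorem hasSum_discriminant_pow (D : PowerSeries ℤ)
    (hD : qExpansion 1 ModularForm.discriminant = PowerSeries.map (Int.castRingHom ℂ) D) (n : ℕ) (τ : ℍ) :
    HasSum (fun m : ℕ ↦ coeff m (PowerSeries.map (Int.castRingHom ℂ) D ^ n) * Function.Periodic.qParam 1 (τ : ℂ) ^ m)
      (ModularForm.discriminant τ ^ n) := by
  induction n with
  | zero =>
    simp only [pow_zero]
    have h : HasSum (fun m : ℕ ↦ if m = 0 then (1 : ℂ) else 0) 1 := by
      convert hasSum_ite_eq 0 (1 : ℂ) using 1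
    convert h using 1
    funext m
    rw [PowerSeries.coeff_one]
    split_ifs with hm
    · subst hm; simp
    · simp
  | succ n ih =>
    rw [pow_succ, pow_succ]
    have h1 := hasSum_qExpansion_discriminant τ
    rw [hD] at h1
    exact Summit.BirchSwinnertonDyer.BirchSwinnertonDyer.Theorems.ManinLocalTwoThree.KummerCubeSigmaLeaves.hasSum_coeff_mul_pow_mul
      ih h1

/-! ### §2 The width-`1` series: `F(τ+1) = F(τ)` and the `𝕢`-form -/

/-- `𝕢₁(τ)ᵐ = e^{2πiτm}`. [folklore] -/
theorem qParam_one_pow (τ : ℍ) (m : ℕ) :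
    Function.Periodic.qParam 1 (τ : ℂ) ^ m = cexp (2 * Real.pi * Complex.I * (τ : ℂ) * m) := by
  rw [Function.Periodic.qParam, ← Complex.exp_nat_mul]
  congr 1
  push_cast
  ring

/-- A function with a width-`1` Fourier series is `1`-periodic: `F(T•τ) = F(τ)`. [folklore] -/
theorem apply_T_smul_of_hasSum {F : ℍ → ℂ} {b : ℕ → ℤ}
    (hb : ∀ τ : ℍ, HasSum (fun n : ℕ ↦ (b n : ℂ) * cexp (2 * Real.pi * Complex.I * (τ : ℂ) * n)) (F τ)) (τ : ℍ) :
    F (ModularGroup.T • τ) = F τ := by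
  have hT : (((ModularGroup.T • τ : ℍ)) : ℂ) = 1 + (τ : ℂ) := by
    rw [UpperHalfPlane.modular_T_smul, UpperHalfPlane.coe_vadd]; push_cast; ring
  have h1 := hb (ModularGroup.T • τ)
  have h2 := hb τ
  have heq : (fun n : ℕ ↦ (b n : ℂ) * cexp (2 * Real.pi * Complex.I * (((ModularGroup.T • τ : ℍ)) : ℂ) * n)) =
      fun n : ℕ ↦ (b n : ℂ) * cexp (2 * Real.pi * Complex.I * (τ : ℂ) * n) := by
    funext n
    rw [hT, show 2 * (Real.pi : ℂ) * Complex.I * (1 + (τ : ℂ)) * n =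
        2 * Real.pi * Complex.I * τ * n + n * (2 * Real.pi * Complex.I) by ring,
      Complex.exp_add, Complex.exp_nat_mul_two_pi_mul_I, mul_one]
  rw [heq] at h1
  exact h1.unique h2

/-! ### §3 The bridge -/

/-- **an's `UnboundedDenominatorsWeight k` from the vendored CDT fact** (proof in the module docstring). [cite: CalegariDimitrovTang2025, Thm. 1.0.1] -/
theorem unboundedDenominatorsWeight_of_CDT (hCDT : CalegariDimitrovTang2025_unboundedDenominators) (k : ℤ) :
    UnboundedDenominatorsWeight k := by
  intro Γ hΓfi F hF hinv hgrowth hser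
  haveI := hΓfi
  obtain ⟨b, hb⟩ := hser
  classical
  -- §a the uniform exponent `k′` over the finitely many cosets of `Γ`
  choose C A m hCAm using hgrowth
  haveI : Finite (SL(2, ℤ) ⧸ Γ) := Subgroup.finite_quotient_of_finiteIndex
  haveI : Fintype (SL(2, ℤ) ⧸ Γ) := Fintype.ofFinite _
  let kq : SL(2, ℤ) ⧸ Γ → ℕ := fun q ↦ ⌈m (q.out)⁻¹⌉₊
  let k' : ℕ := ∑ q, kq q
  have hk' : ∀ q : SL(2, ℤ) ⧸ Γ, m (q.out)⁻¹ ≤ (k' : ℝ) := by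
    intro q
    have h1 : m (q.out)⁻¹ ≤ (kq q : ℝ) := Nat.le_ceil _
    have h2 : kq q ≤ k' := Finset.single_le_sum (fun _ _ ↦ Nat.zero_le _) (Finset.mem_univ q)
    exact h1.trans (by exact_mod_cast h2)
  -- the growth of `F|g` with the uniform exponent
  have hgrow : ∀ g : SL(2, ℤ), ∃ C₀ A₀ : ℝ, ∀ τ : ℍ, A₀ ≤ τ.im →
      ‖(F ∣[k] g) τ‖ ≤ C₀ * Real.exp ((k' : ℝ) * τ.im) := by
    intro g
    set q : SL(2, ℤ) ⧸ Γ := QuotientGroup.mk (g⁻¹) with hq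
    obtain ⟨h, hh⟩ := QuotientGroup.mk_out_eq_mul (s := Γ) (g⁻¹)
    have hrep : F ∣[k] (q.out)⁻¹ = F ∣[k] g := by
      rw [hq, hh, mul_inv_rev, inv_inv, SlashAction.slash_mul, hinv _ (inv_mem h.2)]
    refine ⟨max (C (q.out)⁻¹) 0, A (q.out)⁻¹, fun τ hτ ↦ ?_⟩
    have h1 := hCAm (q.out)⁻¹ τ hτ
    rw [hrep] at h1
    refine h1.trans ?_
    have hexp : Real.exp (m (q.out)⁻¹ * τ.im) ≤ Real.exp ((k' : ℝ) * τ.im) :=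
      Real.exp_le_exp.mpr (mul_le_mul_of_nonneg_right (hk' q) τ.im_pos.le)
    calc C (q.out)⁻¹ * Real.exp (m (q.out)⁻¹ * τ.im)
        ≤ max (C (q.out)⁻¹) 0 * Real.exp (m (q.out)⁻¹ * τ.im) :=
          mul_le_mul_of_nonneg_right (le_max_left _ _) (Real.exp_pos _).le
      _ ≤ max (C (q.out)⁻¹) 0 * Real.exp ((k' : ℝ) * τ.im) :=
          mul_le_mul_of_nonneg_left hexp (le_max_right _ _)
  -- §b the function `f = F·Δ^{k′}` and its stabiliser `K`
  set Dk : ℍ → ℂ := fun τ ↦ ModularForm.discriminant τ ^ k' with hDk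
  set f : ℍ → ℂ := fun τ ↦ F τ * ModularForm.discriminant τ ^ k' with hfdef
  have hfmul : f = F * Dk := by funext τ; simp [hfdef, hDk]
  have hw : (k + 12 * (k' : ℤ)) = k + 12 * (k' : ℤ) := rfl
  have hfslash : ∀ g : SL(2, ℤ), f ∣[k + 12 * (k' : ℤ)] g = (F ∣[k] g) * Dk := by
    intro g
    rw [hfmul, ModularForm.mul_slash_SL2, hDk, discriminant_pow_slash k' g]
  let K : Subgroup SL(2, ℤ) :=
    { carrier := {γ | f ∣[k + 12 * (k' : ℤ)] γ = f}
      mul_mem' := fun {a b} ha hb ↦ by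
        simp only [Set.mem_setOf_eq] at ha hb ⊢
        rw [SlashAction.slash_mul, ha, hb]
      one_mem' := by
        simp only [Set.mem_setOf_eq]
        exact SlashAction.slash_one _ _
      inv_mem' := fun {a} ha ↦ by
        simp only [Set.mem_setOf_eq] at ha ⊢
        have h := SlashAction.slash_mul (k + 12 * (k' : ℤ)) a a⁻¹ f
        rw [mul_inv_cancel, SlashAction.slash_one, ha] at h
        exact h.symm }
  have hmemK : ∀ γ : SL(2, ℤ), γ ∈ K ↔ f ∣[k + 12 * (k' : ℤ)] γ = f := fun _ ↦ Iff.rfl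
  have hΓK : Γ ≤ K := by
    intro γ hγ
    rw [hmemK, hfslash, hinv γ hγ, hfmul]
  have hTK : ModularGroup.T ∈ K := by
    rw [hmemK]
    have hFT : F ∣[k] ModularGroup.T = F := by
      funext τ
      rw [ModularForm.SL_slash_apply, apply_T_smul_of_hasSum hb τ]
      have : denom ModularGroup.T τ = 1 := by
        rw [ModularGroup.denom_apply]
        simp [ModularGroup.coe_T]
      rw [this]
      simp
    rw [hfslash, hFT, hfmul]
  haveI hKfi : K.FiniteIndex := Subgroup.finiteIndex_of_le hΓK
  have h1K : (1 : ℝ) ∈ (K : Subgroup (GL (Fin 2) ℝ)).strictPeriods := by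
    have h := mem_strictPeriods_of_T_pow_mem (Γ := K) (n := 1) (by rw [pow_one]; exact hTK)
    simpa using h
  -- §c holomorphy and boundedness at every cusp: `f : ModularForm K (k + 12k′)`
  obtain ⟨CΔ, AΔ, hCΔ, hΔ⟩ := exists_norm_discriminant_le
  have hΔholo : MDiff (ModularForm.discriminant : ℍ → ℂ) := (CuspForm.discriminant).holo'
  have hfholo : MDiff f := by
    rw [hfmul, hDk]
    exact hF.mul (hΔholo.pow k')
  have hfbdd : ∀ g : SL(2, ℤ), IsBoundedAtImInfty (f ∣[k + 12 * (k' : ℤ)] g) := by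
    intro g
    obtain ⟨C₀, A₀, hg⟩ := hgrow g
    rw [hfslash, UpperHalfPlane.isBoundedAtImInfty_iff]
    refine ⟨max C₀ 0 * CΔ ^ k', max (max A₀ AΔ) 0, fun τ hτ ↦ ?_⟩
    have hA₀ : A₀ ≤ τ.im := (le_max_left _ _).trans ((le_max_left _ _).trans hτ)
    have hAΔ : AΔ ≤ τ.im := (le_max_right _ _).trans ((le_max_left _ _).trans hτ)
    have hF1 : ‖(F ∣[k] g) τ‖ ≤ max C₀ 0 * Real.exp ((k' : ℝ) * τ.im) :=
      (hg τ hA₀).trans (mul_le_mul_of_nonneg_right (le_max_left _ _) (Real.exp_pos _).le)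
    have hD1 : ‖Dk τ‖ ≤ CΔ ^ k' * Real.exp (-(2 * Real.pi * (k' : ℝ) * τ.im)) := by
      rw [hDk]
      simp only [norm_pow]
      calc ‖ModularForm.discriminant τ‖ ^ k'
          ≤ (CΔ * Real.exp (-2 * Real.pi * τ.im)) ^ k' :=
            pow_le_pow_left₀ (norm_nonneg _) (hΔ τ hAΔ) k'
        _ = CΔ ^ k' * Real.exp (-(2 * Real.pi * (k' : ℝ) * τ.im)) := by
            rw [mul_pow, ← Real.exp_nat_mul]; congr 1; ring_nf
    rw [Pi.mul_apply, norm_mul]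
    calc ‖(F ∣[k] g) τ‖ * ‖Dk τ‖
        ≤ (max C₀ 0 * Real.exp ((k' : ℝ) * τ.im)) * (CΔ ^ k' * Real.exp (-(2 * Real.pi * (k' : ℝ) * τ.im))) :=
          mul_le_mul hF1 hD1 (norm_nonneg _) (mul_nonneg (le_max_right _ _) (Real.exp_pos _).le)
      _ = max C₀ 0 * CΔ ^ k' * Real.exp (((k' : ℝ) - 2 * Real.pi * k') * τ.im) := by
          rw [show ((k' : ℝ) - 2 * Real.pi * k') * τ.im = (k' : ℝ) * τ.im + -(2 * Real.pi * (k' : ℝ) * τ.im) by ring,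
            Real.exp_add]; ring
      _ ≤ max C₀ 0 * CΔ ^ k' * 1 := by
          refine mul_le_mul_of_nonneg_left ?_ (mul_nonneg (le_max_right _ _) (pow_nonneg hCΔ _))
          rw [Real.exp_le_one_iff]
          have hπ : (1 : ℝ) ≤ 2 * Real.pi := by nlinarith [Real.pi_gt_three]
          have : ((k' : ℝ) - 2 * Real.pi * k') ≤ 0 := by nlinarith [(Nat.cast_nonneg k' : (0 : ℝ) ≤ k')]
          exact mul_nonpos_of_nonpos_of_nonneg this τ.im_pos.le
      _ = max C₀ 0 * CΔ ^ k' := mul_one _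
  let fK : ModularForm (K : Subgroup (GL (Fin 2) ℝ)) (k + 12 * (k' : ℤ)) :=
    { toFun := f
      slash_action_eq' := by
        intro γ hγ
        obtain ⟨γ₀, hγ₀, rfl⟩ := Subgroup.mem_map.mp hγ
        exact (hmemK γ₀).mp hγ₀
      holo' := hfholo
      bdd_at_cusps' := by
        intro c hc
        rw [Subgroup.IsArithmetic.isCusp_iff_isCusp_SL2Z] at hc
        rw [OnePoint.isBoundedAt_iff_forall_SL2Z hc]
        intro g _
        exact hfbdd g }
  -- §d integer `q`-expansion at period `1`
  obtain ⟨DZ, hDZ⟩ := exists_discriminant_qExpansion_eq_map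
  set B : PowerSeries ℂ := PowerSeries.map (Int.castRingHom ℂ) (PowerSeries.mk b) with hB
  have hsumf : ∀ τ : ℍ, HasSum (fun n : ℕ ↦
      (coeff n (PowerSeries.map (Int.castRingHom ℂ) (PowerSeries.mk b * DZ ^ k'))) • Function.Periodic.qParam 1 (τ : ℂ) ^ n) (fK τ) := by
    intro τ
    have hFτ : HasSum (fun n : ℕ ↦ coeff n B * Function.Periodic.qParam 1 (τ : ℂ) ^ n) (F τ) := by
      convert hb τ using 1
      funext n
      rw [hB, PowerSeries.coeff_map, PowerSeries.coeff_mk, eq_intCast, qParam_one_pow]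
    have hprod := Summit.BirchSwinnertonDyer.BirchSwinnertonDyer.Theorems.ManinLocalTwoThree.KummerCubeSigmaLeaves.hasSum_coeff_mul_pow_mul
      hFτ (hasSum_discriminant_pow DZ hDZ k' τ)
    convert hprod using 1
    · funext n
      rw [smul_eq_mul, hB, map_mul, map_pow]
    · show f τ = _
      rw [hfdef]
  have hint : ∀ n : ℕ, ∃ z : ℤ, coeff n (qExpansion ((1 : ℕ) : ℝ) fK) = (z : ℂ) := by
    intro n
    refine ⟨coeff n (PowerSeries.mk b * DZ ^ k'), ?_⟩
    have h := ModularFormClass.qExpansion_coeff_unique (Γ := (K : Subgroup (GL (Fin 2) ℝ)))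
      (c := fun n ↦ coeff n (PowerSeries.map (Int.castRingHom ℂ) (PowerSeries.mk b * DZ ^ k')))
      one_pos h1K (f := fK) hsumf n
    rw [Nat.cast_one, ← h, PowerSeries.coeff_map, eq_intCast]
  -- §e the vendored fact, then unbundling to `Γ(N)`-invariance
  have h1K' : (((1 : ℕ) : ℝ)) ∈ (K : Subgroup (GL (Fin 2) ℝ)).strictPeriods := by simpa using h1K
  obtain ⟨Γ', g, ⟨N, hN, hle⟩, hg⟩ := hCDT K (k + 12 * (k' : ℤ)) fK 1 one_pos h1K' hint
  refine ⟨N, Nat.pos_of_ne_zero hN, fun γ hγ ↦ ?_⟩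
  have h1 : f ∣[k + 12 * (k' : ℤ)] γ = f := by
    have hmem : (Matrix.SpecialLinearGroup.mapGL ℝ γ : GL (Fin 2) ℝ) ∈ (Γ' : Subgroup (GL (Fin 2) ℝ)) :=
      Subgroup.mem_map_of_mem _ (hle hγ)
    have h := SlashInvariantForm.slash_action_eqn g _ hmem
    rw [hg] at h
    exact h
  rw [hfslash, hfmul] at h1
  funext τ
  have h2 := congrFun h1 τ
  simp only [Pi.mul_apply] at h2
  have hDne : Dk τ ≠ 0 := by rw [hDk]; exact pow_ne_zero _ (ModularForm.discriminant_ne_zero τ)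
  exact mul_right_cancel₀ hDne h2

/-! ### §4 Consequences BY NAME for the UDC line of C3 -/

/-- **The cite conjunct of C3 v21 (`stub_printInputsUDC`) from the vendored fact**: `(∀ k, UnboundedDenominatorsWeight k) ∧ TypeIINoncongruence`
⟸ `CalegariDimitrovTang2025_unboundedDenominators` (the second conjunct is the typer's theorem `typeIINoncongruence_holds`).
[cite: CalegariDimitrovTang2025, Thm. 1.0.1] [cite: KurthLong2008, Prop. 18] -/
theorem printInputsUDC_of_CDT (hCDT : CalegariDimitrovTang2025_unboundedDenominators) :
    (∀ k : ℤ, UnboundedDenominatorsWeight k) ∧ TypeIINoncongruence :=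
  ⟨unboundedDenominatorsWeight_of_CDT hCDT, typeIINoncongruence_holds⟩

/-- **(AN) ⟸ vendored CDT ∧ (AN♮)**: `KummerCubeRootCongruenceOfBounded` from the Literature fact and the content stub. CONDITIONAL.
[cite: CalegariDimitrovTang2025, Thm. 1.0.1] -/
theorem kummerCubeRootCongruenceOfBounded_of_CDT (hCDT : CalegariDimitrovTang2025_unboundedDenominators)
    (hAN : KummerCubeRootCongruenceOfBoundedOfUDC) : KummerCubeRootCongruenceOfBounded :=
  hAN (unboundedDenominatorsWeight_of_CDT hCDT)

/-- **C3 `ManinPrimeToThreeAtNine` ⟸ F₃♮ ∧ CDT (vendored Literature fact, BY NAME) ∧ NC-a ∧ NC-b@9 ∧ BI ∧ AN♮ ∧ RES₃♭** — the lead's v21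
composition `maninPrimeToThreeAtNine_of_katoFactKP_of_udcNine_of_coprimeIsolated` with its cite conjunct discharged from
`CalegariDimitrovTang2025_unboundedDenominators`.  CONDITIONAL reduction; C3 OPEN; BSD is not proved by this.
[cite: CalegariDimitrovTang2025, Thm. 1.0.1] [cite: Kato2004Asterisque, Thm. 9.7 (p. 189)] -/
theorem maninPrimeToThreeAtNine_of_katoFactKP_of_CDT_udcNine_of_coprimeIsolated
    (hK : Literature.NumberTheory.EllipticCurves.kato_neron_isIntegral_twistedSymbolSum_of_additive_three_kp)
    (hCDT : CalegariDimitrovTang2025_unboundedDenominators)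
    (hNa : KummerCoverSubgroup)
    (hNb : ∀ (W : WeierstrassCurve ℚ) [W.IsElliptic] [W.IsGloballyMinimal] {N : ℕ} [NeZero N]
      (D : Literature.NumberTheory.EllipticCurves.ModularForms.ModularParametrizationData W N),
      (∀ z ∈ D.L.lattice, ∃ w ∈ Literature.NumberTheory.EllipticCurves.ModularForms.periodLattice D.f, z = D.c * w) → 9 ∣ N →
      ∀ X₀ Y₀ : ℚ, Summit.BirchSwinnertonDyer.Rank1Residual.ManinAdditive.CuspidalKummerThree.IsShortThreeTorsion W D.c X₀ Y₀ →
      ∀ u : ℂ, u ∉ D.L.lattice → 3 * u ∈ D.L.lattice →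
      (D.c : ℂ) ^ 2 * D.L.weierstrassP u = (X₀ : ℂ) → (D.c : ℂ) ^ 3 * D.L.derivWeierstrassP u / 2 = (Y₀ : ℂ) →
      ∃ γ : Gamma0 N, (γ : SL(2, ℤ)) ∈ Gamma1 N ∧ ¬ KummerPeriodTrivial D u γ)
    (hBI : KummerCubeRootThreeBounded) (hAN : KummerCubeRootCongruenceOfBoundedOfUDC)
    (hRes : Summit.BirchSwinnertonDyer.Rank1Residual.ManinAdditive.CuspidalKummerThree.NoRationalThreeTorsionCoprimeIsolatedResidual) :
    Summit.BirchSwinnertonDyer.BirchSwinnertonDyer.Theses.ManinLocalTwoThree.ManinPrimeToThreeAtNine :=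
  Summit.BirchSwinnertonDyer.BirchSwinnertonDyer.Theorems.ManinLocalTwoThree.maninPrimeToThreeAtNine_of_katoFactKP_of_udcNine_of_coprimeIsolated
    hK (printInputsUDC_of_CDT hCDT) hNa hNb hBI hAN hRes

end Summit.BirchSwinnertonDyer.BirchSwinnertonDyer.Theorems.ManinLocalTwoThree.UDWOfCDT

end
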